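import Summits.QuantumFields.YangMills.Theses.OnsetCalibration

/-!
# Route `OnsetCalibration` — the Assembly item (stmt-QuantumFields-23316)

`Summit.QuantumFields.YangMills.Theses.OnsetCalibration.Assembly`, i.e.
`SubOnsetCeilings → OnsetFloors → OnsetVanishes → InfiniteVolumeContinuum.HypercubicOSDataFromInfiniteVolume`.

Proof (the CALIBRATION of the lattice unit at the onset of the non-triviality floors).  Fix `G` in the SU(2)
class.  `OnsetFloors` (K1) gives a floor datum `(r, v, f, g, h, ε₁, Λ₅, β₅)`; `SubOnsetCeilings` (K2) at that datum
gives `ε₀`; put `ε := min ε₁ ε₀` (floors at level `ε₁` are floors at level `ε`, so the level `ε` is live from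
`β₅` on) and get the ceiling constants `(C, ℓ₄, β₄)`.  The onset set `S β := {s ∈ (0,1] : both floors hold at
(ε, β, s)}` is non-empty for `β ≥ β₅` and bounded by `1`; the calibrated unit `a β` is a chosen element of `S β`
above `sSup (S β) / 2` (`exists_lt_of_lt_csSup`), and `1` when `S β = ∅`.  Then: `0 < a`; `LowerBounds G r a` by
membership; `MomentBounds6 G r a` from K2, because every `s' ≥ 2 a β` exceeds `sSup (S β)` and hence carries no
floor; `a → 0` from `OnsetVanishes` (U): for `β` large no `s ∈ [s₀, 1]` carries the floors, so `a β < s₀`.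
Finally the proved supports of route `InfiniteVolumeContinuum` BY NAME, verbatim as in its deciding theorem
`InfiniteVolumeContinuum.closes`: `IVData_holds`, `IVReflectionPositivity_holds`, `isReflectionPositive_of_rpPos`,
`isHermitian_of_isReflectionPositive`, `InfiniteVolume.E1.stub_ivSigned`.

HONEST LABEL: this closes only the glue item of route `OnsetCalibration`; the leaf (rung R2a-IV, hypercubic OS
data) then rests on the OPEN cruxes K2 `SubOnsetCeilings` (E0′/N32 ceilings in self-located form) and K1
`OnsetFloors` (= the NT residual of the ladder).  No summit and no mass gap is proved here.
-/

set_option autoImplicit false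

noncomputable section

open MeasureTheory Filter Topology
open Literature.MathematicalPhysics.QuantumFieldTheory Literature.MathematicalPhysics.QuantumLattice
open Literature.MathematicalPhysics.AQFT
open Summit.QuantumFields.YangMills.Cruxes.OSLegsFromFemtoAndGap.DlrCollarTransfer

namespace Summit.QuantumFields.YangMills.Theorems.OnsetCalibration

/-- **Assembly of route `OnsetCalibration`** (stmt-QuantumFields-23316): `SubOnsetCeilings → OnsetFloors →
OnsetVanishes → HypercubicOSDataFromInfiniteVolume`, by calibrating the lattice unit `a(β)` at an onset resolution
of the non-triviality floors (choice above `sSup/2` of the onset set) and running the landed supports of route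
`InfiniteVolumeContinuum`.  Glue only: the leaf stays conditional on the open cruxes K1 and K2. -/
theorem assembly_proof : Summit.QuantumFields.YangMills.Theses.OnsetCalibration.Assembly := by
  unfold Summit.QuantumFields.YangMills.Theses.OnsetCalibration.Assembly
  intro hK2 hK1 hU G _ _ _ _ hG hcl
  letI : MeasurableSpace G := borel G
  haveI : BorelSpace G := ⟨rfl⟩
  -- K1: the floor datum
  obtain ⟨r, v, f, g, h, ε₁, Λ₅, β₅, hv, hfg, hgh, hfh, hε₁, hfloor⟩ := hK1 G hG hcl
  -- K2 at that datum: the admissible floor levels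
  obtain ⟨ε₀, hε₀, hK2'⟩ := hK2 G hG hcl r v f g h Λ₅
  have hεpos : 0 < min ε₁ ε₀ := lt_min hε₁ hε₀
  -- the level `ε := min ε₁ ε₀` is live from `β₅` on
  have hlive : ∀ β : ℝ, β₅ ≤ β → ∃ s : ℝ, 0 < s ∧ s ≤ 1 ∧
      (∀ L : ℕ, Λ₅ ≤ s * L → min ε₁ ε₀ ≤ Q2 G r β L s (thetaTest 4 v) v) ∧
      (∀ L : ℕ, Λ₅ ≤ s * L → min ε₁ ε₀ ≤ |Q3 G r β L s f g h|) := by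
    intro β hβ
    obtain ⟨s, hs0, hs1, h2, h3⟩ := hfloor β hβ
    exact ⟨s, hs0, hs1, fun L hL => (min_le_left _ _).trans (h2 L hL),
      fun L hL => (min_le_left _ _).trans (h3 L hL)⟩
  obtain ⟨C, ℓ₄, β₄, hℓ₄, hC, hceil⟩ := hK2' (min ε₁ ε₀) hεpos (min_le_right _ _) ⟨β₅, hlive⟩
  -- the onset set `S β` (opaque, with its membership lemma)
  obtain ⟨S, hS⟩ : ∃ S : ℝ → Set ℝ, ∀ β s, s ∈ S β ↔ (0 < s ∧ s ≤ 1 ∧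
      (∀ L : ℕ, Λ₅ ≤ s * L → min ε₁ ε₀ ≤ Q2 G r β L s (thetaTest 4 v) v) ∧
      (∀ L : ℕ, Λ₅ ≤ s * L → min ε₁ ε₀ ≤ |Q3 G r β L s f g h|)) :=
    ⟨fun β => {s | 0 < s ∧ s ≤ 1 ∧
      (∀ L : ℕ, Λ₅ ≤ s * L → min ε₁ ε₀ ≤ Q2 G r β L s (thetaTest 4 v) v) ∧
      (∀ L : ℕ, Λ₅ ≤ s * L → min ε₁ ε₀ ≤ |Q3 G r β L s f g h|)}, fun _ _ => Iff.rfl⟩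
  have hSbdd : ∀ β, BddAbove (S β) := fun β => ⟨1, fun s hs => ((hS β s).1 hs).2.1⟩
  have hSne : ∀ β : ℝ, β₅ ≤ β → (S β).Nonempty := fun β hβ => by
    obtain ⟨s, hs0, hs1, h2, h3⟩ := hlive β hβ
    exact ⟨s, (hS β s).2 ⟨hs0, hs1, h2, h3⟩⟩
  -- the calibrated unit: an onset resolution above half the top of the onset set
  have hex : ∀ β : ℝ, ∃ s : ℝ, 0 < s ∧ ((S β).Nonempty → s ∈ S β ∧ sSup (S β) / 2 < s) := by
    intro β
    by_cases hne : (S β).Nonempty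
    · have hpos : 0 < sSup (S β) := by
        obtain ⟨s, hs⟩ := hne
        exact lt_of_lt_of_le ((hS β s).1 hs).1 (le_csSup (hSbdd β) hs)
      obtain ⟨s, hs, hlt⟩ := exists_lt_of_lt_csSup hne (show sSup (S β) / 2 < sSup (S β) by linarith)
      exact ⟨s, ((hS β s).1 hs).1, fun _ => ⟨hs, hlt⟩⟩
    · exact ⟨1, one_pos, fun h' => (hne h').elim⟩
  choose a ha_pos ha_mem using hex
  -- U: the unit tends to zero
  have ha0 : Tendsto a atTop (nhds 0) := by
    rw [Metric.tendsto_atTop]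
    intro s₀ hs₀
    obtain ⟨β₁, hβ₁⟩ := hU G hG hcl r v f g h (min ε₁ ε₀) Λ₅ s₀ hεpos hs₀
    refine ⟨max β₁ β₅, fun β hβ => ?_⟩
    have hmem := (hS β (a β)).1 ((ha_mem β (hSne β (le_of_max_le_right hβ))).1)
    rw [Real.dist_0_eq_abs, abs_of_pos (ha_pos β)]
    exact lt_of_not_ge fun hcon => hβ₁ β (le_of_max_le_left hβ) (a β) hcon hmem.2.1 ⟨hmem.2.2.1, hmem.2.2.2⟩
  -- the floors at the calibrated unit, by membership
  have hlb : LowerBounds G r a := by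
    refine ⟨⟨v, min ε₁ ε₀, β₅, Λ₅, hv, hεpos, fun β hβ L hL => ?_⟩,
      ⟨f, g, h, min ε₁ ε₀, β₅, Λ₅, hfg, hgh, hfh, hεpos, fun β hβ L hL => ?_⟩⟩
    · have hmem := (hS β (a β)).1 ((ha_mem β (hSne β hβ)).1)
      exact hmem.2.2.1 L hL
    · have hmem := (hS β (a β)).1 ((ha_mem β (hSne β hβ)).1)
      exact hmem.2.2.2 L hL
  -- the ceilings at the calibrated unit: every `s' ≥ 2 a β` lies above the onset set
  have hmb : MomentBounds6 G r a := by
    refine ⟨C, max β₄ β₅, ℓ₄, hℓ₄, hC, fun β hβ L n q x R hq hR hRa hRL hsep => ?_⟩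
    have hne := hSne β (le_of_max_le_right hβ)
    have hmem := (hS β (a β)).1 ((ha_mem β hne).1)
    have hhalf := (ha_mem β hne).2
    refine hceil β (le_of_max_le_left hβ) (a β) hmem.1 hmem.2.1 ?_ L n q x R hq hR hRa hRL hsep
    intro s' h2s hs1 hFl
    have hs'mem : s' ∈ S β := (hS β s').2 ⟨by linarith [ha_pos β], hs1, hFl.1, hFl.2⟩
    have := le_csSup (hSbdd β) hs'mem
    linarith
  -- the proved supports of route InfiniteVolumeContinuum, by name
  obtain ⟨βk, μ, S₁, T, hdata, hN, hLG, hSym, hTr, hNT, hNG⟩ :=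
    Summit.QuantumFields.YangMills.Theorems.InfiniteVolumeContinuum.IVData_holds G r a ha_pos ha0 hlb hmb
  have hrp := Summit.QuantumFields.YangMills.Theorems.InfiniteVolumeContinuum.IVReflectionPositivity_holds
    G r a βk μ S₁ T ha_pos ha0 hmb hdata
  have hE2 := isReflectionPositive_of_rpPos hrp
  have hE0h := Summit.QuantumFields.YangMills.Theorems.OSLegsFromFemtoAndGap.isHermitian_of_isReflectionPositive
    S₁ hN hE2
  obtain ⟨_, hμ, h0, h1, hS', hT⟩ := id hdata
  -- hyperoctahedral invariance on ⁰𝒮: exact on the lattice, passes to the limit (E1.stub_ivSigned, by name)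
  have hW4 := Summit.QuantumFields.YangMills.Theorems.InfiniteVolume.E1.stub_ivSigned r a βk μ S₁ T ha_pos hμ h0 h1 hS' hT
  exact ⟨r, a, βk, μ, S₁, T, ha_pos, ha0, hdata, hN, hE0h, hLG, fun R hR n F hF => hW4 R hR n F hF, hE2, hSym,
    hTr, hNT, hNG⟩

end Summit.QuantumFields.YangMills.Theorems.OnsetCalibration

end
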